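import Mathlib
import HarnessLib
import Summits.HubbardSuperconductivity.HubbardSuperconductivity.Theorems.KLProgrammeKLRegimeEnginePairTransferOutClassHoutG14Split3
import Summits.HubbardSuperconductivity.HubbardSuperconductivity.Theorems.KLProgrammeKLRegimeEngineV8DoorGfr
import Summits.HubbardSuperconductivity.HubbardSuperconductivity.Theorems.KLProgrammeKLRegimeEngineV8DefsU12bG8
import Summits.HubbardSuperconductivity.HubbardSuperconductivity.Theorems.KLProgrammeKLRegimeEngineV8DefsG14

/-!
# Route `KLProgramme` — ENGINE item stmt-HubbardSuperconductivity-20437 `KLRegimeEngineV17F2`, stub (c) value lane, register #14 «(N₄-PATH)»: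
# THE A-PRIORI QUARTIC ROW ALONG THE CUTOFF PATH AS ONE HYPOTHESIS SHAPE, and the (c) closer's `m`/`M4` blocks of `outClass_hout_klEngGeo14_of_shares_split3` REDUCED TO IT
# (cell gate-hubbard-kl, seat gate-hubbard-kl-p1 g24; pen (R343)(B) located the row, (R344)(A)(3) «(N₄-PATH) STATEMENTS-FIRST = GO», (R345)(A) def-free, p1 g24's)

WHAT.  The out-of-class `hout` consumer of record `outClass_hout_klEngGeo14_of_shares_split3` (…PairTransferOutClassHoutG14Split3, k3c2-p2 g21) carries two
A-PRIORI blocks that no landed table supplies (p1 g24 reading, KL STATUS 2026-08-29 l.10721; pen (R343)(B)):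
* the pair-amplitude block `(hm0 : 0 ≤ m) (hm : m ^ 2 ≤ 2 ^ 8 * (P.Klam * U) ^ 2) (hAm : ∀ t ∈ Icc 0 1, ∀ x y, ‖A j Qm t x y‖ ≤ m)`, and
* the quartic block `(hM40 : 0 ≤ M4) (hM4 : ∀ t ∈ Icc 0 1, ∀ X, ‖V j t X‖ ≤ M4) (hM4K : M4 * M4 ≤ 2 ^ 3 * (P.Klam * U) ^ 2)
  (hM4KG : M4 * M4 * (4 + 8 / 3 * R.Gfr 1 * U ^ 2) ^ 2 ≤ 2 ^ 32 * (P.Klam * U) ^ 2)` (+ the consumer's `hGU : 8 / 3 * R.Gfr 1 * U ^ 2 ≤ 1`),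
where `V j t X` is the 4-point vertex function of the soft-smeared effective action ALONG THE CUTOFF PATH `Λ(t) = Λₙ + t·(Λₙ₊₁ − Λₙ)` at the flow frame `Kₙ`
(the consumer's `hV`) and `A j Qm t` is that same vertex function read at the pair 4-tuples on the bare ball (the consumer's `hAdef`).
This file is DEF-FREE (pen (R345)(A)): the row «(N₄-PATH)» is the HYPOTHESIS SHAPE `hrow : ∀ t ∈ Icc 0 1, ∀ X, ‖V j t X‖ ≤ c₄ * U` stated inline on the consumer's own
literal family `V` (binder `hV` verbatim) — the E1-OWED analytic size (register #14, number of record `a₀ = (c₄/Klam)²`, tolerance `a₀ ≤ 8` for cap8's tail; NOT proved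
here and NOT asserted anywhere in this file) — and
* §1 proves the GENERIC reductions (any families `V`, `A` with `A` = `V` at the pair tuples on the bare ball, else `0`): both blocks follow from the ONE row with
  `M4 := m := c₄ * U` and the ONE number `c₄ ^ 2 ≤ 2 ^ 3 * P.Klam ^ 2`; the frame-slope factor and the consumer's `hGU` are DISCHARGED from the registered coupling
  binder (`U ≤ klEngU₀10 P R c`, hence from `U ≤ klEngU₀12G8 klEngGeo14 P R c`) by the landed doors `klEngU₀10_le_inv_gfr_add_one` (`Gfr₁·U ≤ 1`) and
  `abs_mul_two_pow_24_le_of_le_klEngU₀4` (`U·2²⁴ ≤ 1/8`);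
* §2 instantiates §1 at the consumer's LITERAL `hAdef` / `hV` binders: **`outClass_apriori_blocks_of_quarticPathRow`** — inputs = the consumer's own `A hAdef V hV j Qm`,
  `R.WF2`, `0 < U`, `U ≤ klEngU₀10 P R c`, the row `hrow` and the number `ha₀`; output = the seven binders `hm0 hm hAm` · `hM40 hM4 hM4K hM4KG` (at `m = M4 = c₄ * U`,
  in the consumer's order) `∧ hGU`; twin `…_klEngU₀12G8` at the registered (c) token `U ≤ klEngU₀12G8 klEngGeo14 P R c` (r16 V1 row (c) f3bc8d2f2cad).
So the (c) closer's `hout` needs from the E1 docket exactly ONE a-priori quartic row per `(n, j)` and ONE number.  Composition + real arithmetic; NO definition, no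
instance, no notation; nothing about the model is asserted; nothing here asserts (N₄-PATH), (c), (X), any stub of 20437, K3, the margin or superconductivity.
0 kit · 0 lit.
References: BGM 2006 §3 (3.3)–(3.6) (the quartic running couplings stay `O(U)` above the KL scale — the content of the row) [cite: BenfattoGiulianiMastropietro2006].
-/

noncomputable section

namespace Summit.HubbardSuperconductivity.HubbardSuperconductivity.Theorems.KLRegimeSplit

set_option linter.dupNamespace false -- summit = problem name (single-conjunct summit), D-0017

open Real Set Finset Complex Matrix Literature.MathematicalPhysics.QuantumLattice GrassmannAlgebra
open Literature.Probability.LatticeModels hiding torusSupNorm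
open Summit.HubbardSuperconductivity.HubbardSuperconductivity.Theorems.KLProgrammeLegKernels
open Summit.HubbardSuperconductivity.HubbardSuperconductivity.Theorems.KLRegimeWick
open Summit.HubbardSuperconductivity.HubbardSuperconductivity.Theorems.TwoPointAssembly
open Summit.HubbardSuperconductivity.HubbardSuperconductivity.Theorems.EngineV8
open Summit.HubbardSuperconductivity.HubbardSuperconductivity.Theorems.DispersionFlow

/-! ## §1 Generic reductions: both a-priori blocks from ONE sup row -/

section Generic

variable {L M : ℕ} [NeZero L] [NeZero M] {β U μ : ℝ}

/-- **Cap arithmetic, tail**: `c₄² ≤ 2³·Klam²` ⇒ `(c₄U)·(c₄U) ≤ 2³·(Klam U)²` (the consumer's `hM4K` at `M4 := c₄·U`). -/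
theorem mul_self_le_cap8_of_sq_le {P : SplitConsts} {c₄ : ℝ} (U : ℝ) (ha₀ : c₄ ^ 2 ≤ 2 ^ 3 * P.Klam ^ 2) :
    c₄ * U * (c₄ * U) ≤ 2 ^ 3 * (P.Klam * U) ^ 2 := by
  have hU2 : 0 ≤ U ^ 2 := sq_nonneg U
  calc c₄ * U * (c₄ * U) = c₄ ^ 2 * U ^ 2 := by ring
    _ ≤ 2 ^ 3 * P.Klam ^ 2 * U ^ 2 := mul_le_mul_of_nonneg_right ha₀ hU2
    _ = 2 ^ 3 * (P.Klam * U) ^ 2 := by ring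

/-- **Cap arithmetic, pair block**: `c₄² ≤ 2³·Klam²` ⇒ `(c₄U)² ≤ 2⁸·(Klam U)²` (the consumer's `hm` at `m := c₄·U`, with room `2⁵`). -/
theorem sq_le_two_pow_eight_of_sq_le {P : SplitConsts} {c₄ : ℝ} (U : ℝ) (ha₀ : c₄ ^ 2 ≤ 2 ^ 3 * P.Klam ^ 2) :
    (c₄ * U) ^ 2 ≤ 2 ^ 8 * (P.Klam * U) ^ 2 := by
  have hU2 : 0 ≤ U ^ 2 := sq_nonneg U
  have hK2 : 0 ≤ (P.Klam * U) ^ 2 := sq_nonneg _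
  calc (c₄ * U) ^ 2 = c₄ ^ 2 * U ^ 2 := by ring
    _ ≤ 2 ^ 3 * P.Klam ^ 2 * U ^ 2 := mul_le_mul_of_nonneg_right ha₀ hU2
    _ = 2 ^ 3 * (P.Klam * U) ^ 2 := by ring
    _ ≤ 2 ^ 8 * (P.Klam * U) ^ 2 := mul_le_mul_of_nonneg_right (by norm_num) hK2

/-- **Cap arithmetic, frame-slope factor**: with `g := 8/3·Gfr₁·U² ∈ [0,1]`, `(c₄U)²·(4 + g)² ≤ 2³·25·(Klam U)² ≤ 2³²·(Klam U)²` (the consumer's `hM4KG`). -/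
theorem mul_self_mul_gfr_sq_le_of_sq_le {P : SplitConsts} {R : RenConsts} {c₄ : ℝ} (U : ℝ) (ha₀ : c₄ ^ 2 ≤ 2 ^ 3 * P.Klam ^ 2)
    (hg0 : 0 ≤ 8 / 3 * R.Gfr 1 * U ^ 2) (hGU : 8 / 3 * R.Gfr 1 * U ^ 2 ≤ 1) :
    c₄ * U * (c₄ * U) * (4 + 8 / 3 * R.Gfr 1 * U ^ 2) ^ 2 ≤ 2 ^ 32 * (P.Klam * U) ^ 2 := by
  have h8 := mul_self_le_cap8_of_sq_le (P := P) U ha₀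
  have hsq : (4 + 8 / 3 * R.Gfr 1 * U ^ 2) ^ 2 ≤ 25 := by nlinarith
  have hcc : 0 ≤ c₄ * U * (c₄ * U) := mul_self_nonneg _
  have hK2 : 0 ≤ (P.Klam * U) ^ 2 := sq_nonneg _
  calc c₄ * U * (c₄ * U) * (4 + 8 / 3 * R.Gfr 1 * U ^ 2) ^ 2 ≤ 2 ^ 3 * (P.Klam * U) ^ 2 * 25 :=
        mul_le_mul h8 hsq (sq_nonneg _) (by positivity)
    _ ≤ 2 ^ 32 * (P.Klam * U) ^ 2 := by nlinarith

/-- **The frame-slope factor from the registered coupling binder**: `R.WF`, `0 < U ≤ klEngU₀10 P R c` ⇒ `0 ≤ 8/3·Gfr₁·U² ≤ 1` — by the landed doors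
`klEngU₀10_le_inv_gfr_add_one` (`U ≤ 1/(Gfr₁ + 1)`, so `Gfr₁·U ≤ 1`) and `abs_mul_two_pow_24_le_of_le_klEngU₀4` (`U·2²⁴ ≤ 1/8`). This is also the consumer's own `hGU`. -/
theorem gfr_one_mul_sq_le_one_of_le_klEngU₀10 {P : SplitConsts} {R : RenConsts} (hR : R.WF) {c U : ℝ} (hU : 0 < U) (hU10 : U ≤ klEngU₀10 P R c) :
    0 ≤ 8 / 3 * R.Gfr 1 * U ^ 2 ∧ 8 / 3 * R.Gfr 1 * U ^ 2 ≤ 1 := by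
  have hG : 0 ≤ R.Gfr 1 := hR.2.2 1
  refine ⟨by positivity, ?_⟩
  have hinv : U ≤ 1 / (R.Gfr 1 + 1) := hU10.trans (klEngU₀10_le_inv_gfr_add_one P hR c (by norm_num))
  have hG1 : 0 < R.Gfr 1 + 1 := by linarith
  have hGU1 : R.Gfr 1 * U ≤ 1 := by
    have h1 : (R.Gfr 1 + 1) * U ≤ 1 := by
      calc (R.Gfr 1 + 1) * U ≤ (R.Gfr 1 + 1) * (1 / (R.Gfr 1 + 1)) := mul_le_mul_of_nonneg_left hinv hG1.le
        _ = 1 := by field_simp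
    nlinarith
  have h24 := abs_mul_two_pow_24_le_of_le_klEngU₀4 hU (hU10.trans (klEngU₀10_le_klEngU₀4 P R c))
  rw [abs_of_pos hU] at h24
  have hUsmall : U ≤ 3 / 8 := by nlinarith
  calc 8 / 3 * R.Gfr 1 * U ^ 2 = 8 / 3 * (R.Gfr 1 * U) * U := by ring
    _ ≤ 8 / 3 * 1 * (3 / 8) := by gcongr
    _ = 1 := by norm_num

/-- **GENERIC REDUCTION.**  For ANY quartic family `V` and ANY matrix family `A` that reads `V` at the pair 4-tuples on the bare ball (and `0` off it), ONE sup row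
`‖V j t X‖ ≤ c₄·U` on `t ∈ [0,1]` with the number `c₄² ≤ 2³·Klam²` and `0 ≤ g ≤ 1` (`g = 8/3·Gfr₁·U²`) gives the consumer's seven a-priori binders with
`m = M4 = c₄·U`: `(0 ≤ m ∧ m² ≤ 2⁸(KlamU)² ∧ ‖A j Qm t x y‖ ≤ m) ∧ (0 ≤ M4 ∧ ‖V j t X‖ ≤ M4 ∧ M4·M4 ≤ 2³(KlamU)² ∧ M4·M4·(4+g)² ≤ 2³²(KlamU)²)`. -/
theorem apriori_blocks_of_sup_row {P : SplitConsts} {R : RenConsts} (V : ℕ → ℝ → (Fin 4 → HubbardFieldIdx L M) → ℂ)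
    (A : ℕ → TorusSite 2 L → ℝ → Matrix (TorusSite 2 L) (TorusSite 2 L) ℂ) (j : ℕ) (Qm : TorusSite 2 L)
    (hAV : ∀ t (k k' : TorusSite 2 L), A j Qm t k k' = if k ∈ klBall L μ 0 ∧ k' ∈ klBall L μ 0 then
      V j t ![(((omega0 M, k'), 0), 0), ((((omega0 M).rev, Qm - k'), 1), 0), ((((omega0 M).rev, Qm - k), 1), 1), (((omega0 M, k), 0), 1)] else 0)
    {c₄ : ℝ} (hrow : ∀ t ∈ Icc (0 : ℝ) 1, ∀ X, ‖V j t X‖ ≤ c₄ * U) (ha₀ : c₄ ^ 2 ≤ 2 ^ 3 * P.Klam ^ 2)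
    (hg0 : 0 ≤ 8 / 3 * R.Gfr 1 * U ^ 2) (hGU : 8 / 3 * R.Gfr 1 * U ^ 2 ≤ 1) :
    (0 ≤ c₄ * U ∧ (c₄ * U) ^ 2 ≤ 2 ^ 8 * (P.Klam * U) ^ 2 ∧ ∀ t ∈ Icc (0 : ℝ) 1, ∀ x y, ‖A j Qm t x y‖ ≤ c₄ * U) ∧
      (0 ≤ c₄ * U ∧ (∀ t ∈ Icc (0 : ℝ) 1, ∀ X, ‖V j t X‖ ≤ c₄ * U) ∧ c₄ * U * (c₄ * U) ≤ 2 ^ 3 * (P.Klam * U) ^ 2 ∧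
        c₄ * U * (c₄ * U) * (4 + 8 / 3 * R.Gfr 1 * U ^ 2) ^ 2 ≤ 2 ^ 32 * (P.Klam * U) ^ 2) := by
  have h0 : 0 ≤ c₄ * U := (norm_nonneg _).trans (hrow 0 ⟨le_rfl, zero_le_one⟩ fun _ => (((omega0 M, 0), 0), 0))
  refine ⟨⟨h0, sq_le_two_pow_eight_of_sq_le (P := P) U ha₀, fun t ht x y => ?_⟩,
    ⟨h0, hrow, mul_self_le_cap8_of_sq_le (P := P) U ha₀, mul_self_mul_gfr_sq_le_of_sq_le (P := P) U ha₀ hg0 hGU⟩⟩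
  rw [hAV t x y]
  split_ifs with hxy
  · exact hrow t ht _
  · simpa using h0

end Generic

/-! ## §2 At the consumer's LITERAL `hAdef` / `hV`: the (c) closer's ONE CALL -/

section Literal

variable (L M : ℕ) [NeZero L] [NeZero M] (β U μ : ℝ) {R : RenConsts}

set_option maxHeartbeats 800000 in -- two literal vertex-function binders (the consumer's `hAdef`/`hV` verbatim); unfolding only
/-- **`outClass_apriori_blocks_of_quarticPathRow`** — the `m`-block `(hm0, hm, hAm)`, the `M4`-block `(hM40, hM4, hM4K, hM4KG)` AND `hGU` of
`outClass_hout_klEngGeo14_of_shares_split3`, all from the ONE row «(N₄-PATH)» `hrow : ∀ t ∈ Icc 0 1, ∀ X, ‖V j t X‖ ≤ c₄ * U` (E1-owed analytic row, register #14,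
pen (R343)(B); this file names its shape and discharges the cap arithmetic only) and the ONE number `ha₀ : c₄ ^ 2 ≤ 2 ^ 3 * P.Klam ^ 2`, at `m = M4 := c₄ * U`.
Binders `A hAdef V hV j Qm` are the consumer's VERBATIM (pass the same terms); `R.WF2`, `0 < U`, `U ≤ klEngU₀10 P R c` are the (c) stub's registered binders
(`klEngU₀12G8_le_klEngU₀10`).  The row is a HYPOTHESIS; nothing here asserts it. -/
theorem outClass_apriori_blocks_of_quarticPathRow (hR : R.WF2) (hU : 0 < U) {P : SplitConsts} {c : ℝ} (hU10 : U ≤ klEngU₀10 P R c) {n : ℕ}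
    (A : ℕ → TorusSite 2 L → ℝ → Matrix (TorusSite 2 L) (TorusSite 2 L) ℂ)
    (hAdef : A = fun j Qm t => Matrix.of fun k k' : TorusSite 2 L => if k ∈ klBall L μ 0 ∧ k' ∈ klBall L μ 0 then
      vertexFn L M β (gaussConv ℂ (softCovOf L M β μ (klFlowFrameU L M β U μ n) (softSymbolCompl L M β μ (klFlowFrameU L M β U μ n) (n + 1) j) + hubbardCovAboveCT L M β μ 0 (klFlowFrameU L M β U μ n) (klScale klE0 (n + 1)) - hubbardCovAboveCT L M β μ 0 (klFlowFrameU L M β U μ n)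
              (klScale klE0 n + t * (klScale klE0 (n + 1) - klScale klE0 n))) (hubbardEffectiveActionCT L M β U μ 0 (klFlowFrameU L M β U μ n) (klScale klE0 n + t * (klScale klE0 (n + 1) - klScale klE0 n)))) 4
              ![(((omega0 M, k'), 0), 0), ((((omega0 M).rev, Qm - k'), 1), 0), ((((omega0 M).rev, Qm - k), 1), 1), (((omega0 M, k), 0), 1)]
      else 0)
    (V : ℕ → ℝ → (Fin 4 → HubbardFieldIdx L M) → ℂ) (hV : V = fun j t X => vertexFn L M β (gaussConv ℂ (softCovOf L M β μ (klFlowFrameU L M β U μ n) (softSymbolCompl L M β μ (klFlowFrameU L M β U μ n) (n + 1) j) + hubbardCovAboveCT L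
            M β μ 0 (klFlowFrameU L M β U μ n) (klScale klE0 (n + 1)) - hubbardCovAboveCT L M β μ 0 (klFlowFrameU L M β U μ n) (klScale klE0 n + t * (klScale klE0 (n + 1) - klScale klE0 n))) (hubbardEffectiveActionCT L M β U μ 0 (klFlowFrameU L M β U μ n)
            (klScale klE0 n + t * (klScale klE0 (n + 1) - klScale klE0 n)))) 4 X)
    (j : ℕ) (Qm : TorusSite 2 L) {c₄ : ℝ} (hrow : ∀ t ∈ Icc (0 : ℝ) 1, ∀ X, ‖V j t X‖ ≤ c₄ * U) (ha₀ : c₄ ^ 2 ≤ 2 ^ 3 * P.Klam ^ 2) :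
    ((0 ≤ c₄ * U ∧ (c₄ * U) ^ 2 ≤ 2 ^ 8 * (P.Klam * U) ^ 2 ∧ ∀ t ∈ Icc (0 : ℝ) 1, ∀ x y, ‖A j Qm t x y‖ ≤ c₄ * U) ∧
      (0 ≤ c₄ * U ∧ (∀ t ∈ Icc (0 : ℝ) 1, ∀ X, ‖V j t X‖ ≤ c₄ * U) ∧ c₄ * U * (c₄ * U) ≤ 2 ^ 3 * (P.Klam * U) ^ 2 ∧
        c₄ * U * (c₄ * U) * (4 + 8 / 3 * R.Gfr 1 * U ^ 2) ^ 2 ≤ 2 ^ 32 * (P.Klam * U) ^ 2)) ∧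
      8 / 3 * R.Gfr 1 * U ^ 2 ≤ 1 := by
  obtain ⟨hg0, hGU⟩ := gfr_one_mul_sq_le_one_of_le_klEngU₀10 (P := P) hR.1 hU hU10
  have hAV : ∀ t (k k' : TorusSite 2 L), A j Qm t k k' = if k ∈ klBall L μ 0 ∧ k' ∈ klBall L μ 0 then
      V j t ![(((omega0 M, k'), 0), 0), ((((omega0 M).rev, Qm - k'), 1), 0), ((((omega0 M).rev, Qm - k), 1), 1), (((omega0 M, k), 0), 1)] else 0 := by
    intro t k k'
    subst hAdef hV
    simp only [Matrix.of_apply]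
  exact ⟨apriori_blocks_of_sup_row (P := P) (R := R) V A j Qm hAV hrow ha₀ hg0 hGU, hGU⟩

/-- **The same at the registered (c)-stub coupling token** `U ≤ klEngU₀12G8 klEngGeo14 P R c` (r16 V1 row (c) f3bc8d2f2cad), via `klEngU₀12G8_le_klEngU₀10`.
The row «(N₄-PATH)» `hrow` is a HYPOTHESIS (E1-owed); nothing here asserts it. -/
theorem outClass_apriori_blocks_of_quarticPathRow_klEngU₀12G8 (hR : R.WF2) (hU : 0 < U) {P : SplitConsts} {c : ℝ}
    (hUle : U ≤ klEngU₀12G8 klEngGeo14 P R c) {n : ℕ}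
    (A : ℕ → TorusSite 2 L → ℝ → Matrix (TorusSite 2 L) (TorusSite 2 L) ℂ)
    (hAdef : A = fun j Qm t => Matrix.of fun k k' : TorusSite 2 L => if k ∈ klBall L μ 0 ∧ k' ∈ klBall L μ 0 then
      vertexFn L M β (gaussConv ℂ (softCovOf L M β μ (klFlowFrameU L M β U μ n) (softSymbolCompl L M β μ (klFlowFrameU L M β U μ n) (n + 1) j) + hubbardCovAboveCT L M β μ 0 (klFlowFrameU L M β U μ n) (klScale klE0 (n + 1)) - hubbardCovAboveCT L M β μ 0 (klFlowFrameU L M β U μ n)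
              (klScale klE0 n + t * (klScale klE0 (n + 1) - klScale klE0 n))) (hubbardEffectiveActionCT L M β U μ 0 (klFlowFrameU L M β U μ n) (klScale klE0 n + t * (klScale klE0 (n + 1) - klScale klE0 n)))) 4
              ![(((omega0 M, k'), 0), 0), ((((omega0 M).rev, Qm - k'), 1), 0), ((((omega0 M).rev, Qm - k), 1), 1), (((omega0 M, k), 0), 1)]
      else 0)
    (V : ℕ → ℝ → (Fin 4 → HubbardFieldIdx L M) → ℂ) (hV : V = fun j t X => vertexFn L M β (gaussConv ℂ (softCovOf L M β μ (klFlowFrameU L M β U μ n) (softSymbolCompl L M β μ (klFlowFrameU L M β U μ n) (n + 1) j) + hubbardCovAboveCT L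
            M β μ 0 (klFlowFrameU L M β U μ n) (klScale klE0 (n + 1)) - hubbardCovAboveCT L M β μ 0 (klFlowFrameU L M β U μ n) (klScale klE0 n + t * (klScale klE0 (n + 1) - klScale klE0 n))) (hubbardEffectiveActionCT L M β U μ 0 (klFlowFrameU L M β U μ n)
            (klScale klE0 n + t * (klScale klE0 (n + 1) - klScale klE0 n)))) 4 X)
    (j : ℕ) (Qm : TorusSite 2 L) {c₄ : ℝ} (hrow : ∀ t ∈ Icc (0 : ℝ) 1, ∀ X, ‖V j t X‖ ≤ c₄ * U) (ha₀ : c₄ ^ 2 ≤ 2 ^ 3 * P.Klam ^ 2) :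
    ((0 ≤ c₄ * U ∧ (c₄ * U) ^ 2 ≤ 2 ^ 8 * (P.Klam * U) ^ 2 ∧ ∀ t ∈ Icc (0 : ℝ) 1, ∀ x y, ‖A j Qm t x y‖ ≤ c₄ * U) ∧
      (0 ≤ c₄ * U ∧ (∀ t ∈ Icc (0 : ℝ) 1, ∀ X, ‖V j t X‖ ≤ c₄ * U) ∧ c₄ * U * (c₄ * U) ≤ 2 ^ 3 * (P.Klam * U) ^ 2 ∧
        c₄ * U * (c₄ * U) * (4 + 8 / 3 * R.Gfr 1 * U ^ 2) ^ 2 ≤ 2 ^ 32 * (P.Klam * U) ^ 2)) ∧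
      8 / 3 * R.Gfr 1 * U ^ 2 ≤ 1 :=
  outClass_apriori_blocks_of_quarticPathRow L M β U μ hR hU (hUle.trans (klEngU₀12G8_le_klEngU₀10 klEngGeo14 P R c)) A hAdef V hV j Qm hrow ha₀

end Literal

end Summit.HubbardSuperconductivity.HubbardSuperconductivity.Theorems.KLRegimeSplit

end
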